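import Summits.QuantumFields.QCD.Theses.GaussianLinkFrames
import Summits.QuantumFields.QCD.Theorems.PauliWegnerSeaFMClosureUnquenchedRepairedC2TwoStar
import Summits.QuantumFields.QCD.Theorems.GaussianLinkFramesPadTheFibreDefs
import Summits.QuantumFields.QCD.Theorems.GaussianLinkFramesFrameFMClosureTwoStarOfPaddedAux8
import Summits.QuantumFields.QCD.Theorems.GaussianLinkFramesFrameFMClosureTwoStarOfPaddedAux9
import Summits.QuantumFields.QCD.Theorems.GaussianLinkFramesFrameFMClosureStubPlacementCollar

/-!
# Line `pad-the-fibre` — skeleton for crux `GaussianLinkFrames.FrameFMClosure` (stmt-QuantumFields-17375)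

Crux (fixed, by name): `FrameFMClosure = FrameAPrioriBound → Core`,
`Core = ∀ N_f reg m > 0, Input → Conclusion` (the one-scale phase-quenched fractional-moment input on a
log-scale shell implies clause (ii) of `WilsonMobilityGap.MobilityGap`); `Core` is byte-identical with the
core of the sibling crux `PauliWegnerSea.FMClosureUnquenched` (stmt-11512; `frame_iff` below is `Iff.rfl`).

## The line (idea card `Ideas/pad-the-fibre.md`, triage `TRIAGE-r1-1.md` / `TRIAGE-r1-2.md`: pass, pass)

The landed Aizenman–Schenker–Friedrich–Hundertmark bootstrap (`Theorems/PauliWegnerSeaFMClosureUnquenched*`)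
consumes cofactor domination ONLY through the averaged two-star package `∀ N_f, TwoStarBounds N_f`, and the
registered line `sibling-graft` feeds that package from K1♭ `LocalCofactorDomination` — uniform domination on
TWO-STAR refit fibres (≤ 16 links), which is hostage to realisable semi-dark exteriors (stmt-11510's question;
`Theorems/FibreCofactorDomination/Negative/…FalseOfDarkLeaf`, p97034).  This line PADS THE FIBRE: the refit
region becomes the two stars plus one even `4⁴` pad per point (`ebox · 1`, 256 sites, 768 links,
bipartite-balanced) holding the point in its inner `2⁴` core, with the in-layer links of chosen boundary
layers of the pad allowed to stay frozen (what the bootstrap can afford next to the depletion sets `W`, `Λᶜ`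
of clause (T1)), and the domination inequality is asked only for these CANONICAL regions and only when the
effective (touched) region is bipartite-BALANCED (triage r1-1 sharpen 1 (a)+(b): supersets and unbalanced
clippings carry structural doubler kernels at `m₀ = -4`, kit j026101).  K1♭ implies the padded statement
(`padded_of_localCofactorDomination`, PROVED), so stub 1 is WEAKER than sibling-graft's stub 1; the
fixed-spinor/tree-gauge construction behind every abstract semi-dark point on record charges no core site
of a balanced pad under any adversarial spanning tree tested (card item 2; kit j025258–j025530).

## Registered stubs

* `stub_paddedDomination : PaddedCofactorDominationLarge` — deterministic, measure-free, the line's crux-sized (RESHAPE gen 1: asked for `4 ≤ S` only)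
  lemma (L).  Proof programme (card item 3): port compression to one finite pencil, flat-band kernel
  section over the function field, graded chiral cut lemma on interior pad links, propagation around the
  pad's plaquettes to invisibility at core sites, radial compactification of the port data.
* RESHAPE gen 2: former `stub_twoStarOfPadded` is PROVED (`twoStarBounds_of_paddedLarge`, via the landed region-generic re-run
  `PadTheFibreTwoStar.twoStarBounds_of_placements`, helpers 1–9) modulo the two PLACEMENT stubs `stub_placementSides` (2a) and
  `stub_placementCollar` (2b): canonical balanced pad placements for the admissible sides resp. the thick collar.
  — the re-run of the landed `VonMisesCirclesC1.stub_twoStar` (TwoStarC1 + Aux1–7) with the band law at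
  `n = 16 + 2·768` links and the pads placed clause by clause (M–L, no new analysis; placement recipe §1).
* `stub_farStability : ∀ N_f, FarStability N_f` — SHARED verbatim (name and signature) with `sibling-graft`
  and with stmt-11512's registered skeleton: the physical stub (XL).
* `stub_corners : (∀ N_f, UnitShellLowerBound N_f) ∧ (∀ N_f reg m > 0, InwardExtension N_f reg m)` — SHARED
  verbatim with `sibling-graft`: corners A5 ∧ A6 of `Core` AS TYPED, held MISSTATED by every seat on both
  cruxes (`LEAD-1.md`, `Lines/Sketch-dead.md` "common wall", `Disproof.lean` §5 / sibling Disproof §4–§5).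
  NOT attacked by this line; carried only so that the composition concludes the crux as typed, by name.
  Under each restatement on record (R0+R1 outward, R3 profiled, 11512's K2-out) it disappears and the line
  is stubs 1–3: §4 proves the restated forms from stubs 1–3 outright.

`core_of_four : stub₁ → stub₃ → stub₄ → (FrameAPrioriBound → ∀ N_f reg m > 0, Input → Conclusion)` (stubs 2a/2b enter through
`twoStarBounds_of_paddedLarge`) is sorry-free and `FrameFMClosure_of : FrameFMClosure := frame_iff.mpr (core_of_four stub_…)` is the one
theorem concluding the crux by name (the four remaining `stub_*` are the only sorries of the file; `stub_placementCollar` LANDED p171200).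

§0 crux unbundled · §1 pad vocabulary (now imported from `Theorems/GaussianLinkFramesPadTheFibreDefs.lean`, p168977) · §2 stubs ·
§3 composition · §4 restatement-readiness (R1 / K2-out from stubs 1–3, proved) · §5 Disproof / Negative used.

References: Aizenman–Schenker–Friedrich–Hundertmark, CMP 224 (2001) 219, Lemmas 4–6, Thm 2 [AizenmanEtAl2001];
Aizenman–Molchanov, CMP 157 (1993) 245 [AizenmanMolchanov1993]; Elgart–Shamis–Sodin, JEMS 16 (2014) 909
(doi:10.4171/jems/451; arXiv:1201.2211); Aizenman–Warzel, *Random Operators* (AMS 2015) ch. 11 [AizenmanWarzel2015].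
-/

noncomputable section

namespace Summit.QuantumFields.QCD.Cruxes.FrameFMClosure.PadTheFibre

open scoped BigOperators
open MeasureTheory Filter
open Literature.MathematicalPhysics.QuantumFieldTheory Literature.MathematicalPhysics.QuantumLattice
  Literature.Probability.LatticeModels
open Summit.QuantumFields.QCD.Theorems.VonMisesCircles
open Summit.QuantumFields.QCD.Theorems.VonMisesCirclesC1
open Summit.QuantumFields.QCD.Theorems.VonMisesCirclesC2
open Summit.QuantumFields.QCD.Theorems.VonMisesCirclesC2B
open Summit.QuantumFields.QCD.Theorems.PadTheFibre
open Summit.QuantumFields.QCD.Theorems.PadTheFibreTwoStar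

local notation "𝔾" => Matrix.specialUnitaryGroup (Fin 3) ℂ

/-! ## §0 The crux unbundled -/

/-- `FrameFMClosure` is literally `FrameAPrioriBound → ∀ N_f reg m > 0, Input → Conclusion` in the landed
vocabulary of `Theorems/PauliWegnerSeaFMClosureUnquenchedDefs.lean` (definitional unfolding). -/
theorem frame_iff :
    Summit.QuantumFields.QCD.Theses.GaussianLinkFrames.FrameFMClosure ↔
      (Summit.QuantumFields.QCD.Theses.GaussianLinkFrames.FrameAPrioriBound →
        ∀ (Nf : ℕ) (reg : QCDRegularisation Nf) (m : Fin Nf → ℝ), (∀ f, 0 < m f) →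
          Input Nf reg m → Conclusion Nf reg m) :=
  Iff.rfl

/-! ## §1 Pad vocabulary and padded cofactor domination

RESHAPE (lead a1, 2026-08-17): the vocabulary `starLinks`, `padLinks`, `padFrozen`, `IsPadRegion`, `touched`, `Balanced`,
`PaddedCofactorDomination` and the proved implication `padded_of_localCofactorDomination : LocalCofactorDomination →
PaddedCofactorDomination` (K1♭ ⇒ padded) now live VERBATIM in the landed
`Theorems/GaussianLinkFramesPadTheFibreDefs.lean` (p168977, namespace `Summit.QuantumFields.QCD.Theorems.PadTheFibre`,
opened above), so that the registered stubs land under `Theorems/` by name and signature.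
RESHAPE gen 1 (lead a1, same day): stubs 1–2 now use `PaddedCofactorDominationLarge` (= the same statement asked for `4 ≤ S` only,
appended to the Defs file, p169524): worker finding — on the `5⁴`/`7⁴` tori the `Balanced` guard can hold vacuously (straight odd
cycles inside two pads), so the unrestricted stub asserted domination on large proper fibres unprotected by balance; the landed
re-run consumes `4 ≤ S` only (`PadTheFibreTwoStar.twoStarBounds_of_placements`, small tori by `regionDom_small_of_sideWitness`). -/

/-! ## §2 Registered stubs -/

/-- **stub 1 — padded cofactor domination** (L; deterministic spectral geometry of Wilson–Dirac refit fibres; the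
line's own crux-sized lemma).  Why plausibly true: γ₅-hermiticity of every side matrix (adjugate pole-free; at a
corank-one point `adj_{xy} = u(x) (γ₅u)(y)†` for the kernel section `u`), and with `x` in the CORE of a balanced,
plaquette-rich pad the tree-gauge ⊗ chirally-cut-spinor construction of kernel sections charges no core site
(card item 2, ansatz rank/visibility ladder, kit j025258/j025267/j025287/j025351/j025485/j025530: core, collar
and Dirichlet geometries invisible `≤ 4·10⁻¹⁴`; stars, thin cells, open faces/edges/corners visible).  Landed
special case: the hopping window `41/10 ≤ |m₀+4|` via K1♭ (`VonMisesCirclesC2B.localCofactorDomination_of_window`)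
and `padded_of_localCofactorDomination`.  Why it might fail: a REALISABLE visible semi-dark exterior for a padded
pencil (refutes it), or an abstract one (kills the exterior-free proof programme, card item 3); untested
geometries: several frozen layers at a `Λ`-corner with re-balancing rungs dropped, depth-2 corner placements in
`ebox` sides, Dirichlet cavities (line card, Cheapest falsifier). -/
theorem stub_paddedDomination : PaddedCofactorDominationLarge := by
  sorry

/-- **stub 2a — the (sides) placements from padded domination on large tori** (RESHAPE gen 2, lead a1, 2026-08-17;
combinatorics, L): for every probe mass in `[-9,1]`, every `S ≥ 4`, every side `A ∈ {ebox, eboxᶜ, ballᶜ}` and `a, b ∈ A` a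
refit region of `≤ n₁` links (stars ∪ two canonical pad regions with BALANCED touched region) dominating the `(a,b)` adjugate
block of `D_A ⊕ 1` along its fibre — VERBATIM the hypothesis `hA` of the landed
`PadTheFibreTwoStar.twoStarBounds_of_placements` (helper 8).  Worker-1 estimate ≈ 1800–2600 lines (chart lemmas `ebox ∩ pad`,
`ball ∩ pad`, flips in a general direction, bespoke two-piece matchings at the corners of thin complements: report
`work/stubs/stub_twoStarOfPadded-REPORT.md` §(A)).  Why it might fail: a side/corner configuration admitting NO canonical balanced
placement (none found; the antipodal corner of `(ebox z (S-1))ᶜ` needs one frozen layer or two `e₀`-offset pads). -/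
theorem stub_placementSides : PaddedCofactorDominationLarge →
      ∃ (n₁ : ℕ) (C₁ : ℝ), 0 < C₁ ∧ ∀ (m₀ : ℝ), -9 ≤ m₀ → m₀ ≤ 1 → ∀ (S : ℕ), 4 ≤ S → ∀ (z : TorusSite 4 (2 * S +
      1)) (r : ℕ), 1 ≤ r → r + 1 ≤ S → ∀ (A : Finset (TorusSite 4 (2 * S + 1))), (A = ebox S z r ∨ A = (ebox S z r)ᶜ
      ∨ A = (ball S z r)ᶜ) → ∀ (a b : TorusSite 4 (2 * S + 1)), a ∈ A → b ∈ A → ∃ R : Finset (Edge 4 (2 * S + 1)),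
      R.card ≤ n₁ ∧ ∀ U W : GaugeConfig 4 (2 * S + 1) (Matrix.specialUnitaryGroup (Fin 3) ℂ), blockNorm ((sideMatrix
      A (wilsonD (fun e => if e ∈ R then W e else U e) m₀)).adjugate) a b ≤ C₁ * ⨆ W' : GaugeConfig 4 (2 * S + 1)
      (Matrix.specialUnitaryGroup (Fin 3) ℂ), ‖(sideMatrix A (wilsonD (fun e => if e ∈ R then W' e else U e)
      m₀)).det‖ := by
  sorry

/-! **stub 2b — the (collar) placements: LANDED** (wave-2 worker, 2026-08-17T17:00Z):
`Summit.QuantumFields.QCD.Cruxes.FrameFMClosure.PadTheFibre.stub_placementCollar`, p171200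
(`Theorems/GaussianLinkFramesFrameFMClosureStubPlacementCollar.lean`, helpers `…PlacementCollarAux1–6` p170847 p171000 p171019 p171047
p171076 p171176, ns `PadTheFibreCollar`; uniform construction: pad centres with `b₀ ≡ ℓ (mod 2)` so all 0-flips align, inner pads one
frozen layer, outer pads unfrozen block + one rung per excluded layer, pairing = aligned/complementary global 0-flips; n₂ = 2064, C₂ = C₀).
The theorem is imported above under the registered name, so it is no longer declared here. -/

/-- **The two-star package from padded domination on large tori** (former stub 2, now PROVED modulo stubs 2a/2b): the landed
region-generic ASFH re-run `twoStarBounds_of_placements` (helpers 1–8, p168136 … ) fed with the (univ) placement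
`univPlacement_of_paddedLarge` (helper 9) and the two placement stubs. -/
theorem twoStarBounds_of_paddedLarge (hP : PaddedCofactorDominationLarge) : ∀ Nf : ℕ, TwoStarBounds Nf :=
  twoStarBounds_of_placements fibreBandLaw_holds c1_sideWitness (univPlacement_of_paddedLarge hP)
    (stub_placementSides hP) (stub_placementCollar hP)

/-- **stub 3 — far stability of the exit moment across a thick collar, every `N_f`** (XL, the physical stub;
SHARED verbatim with `sibling-graft` and with the registered skeleton of stmt-QuantumFields-11512):
`E[A Ψ] ≤ C(1+|β|)^p(1+ℓ)^p ((E A)^θ + E A) E Ψ` for the inside factor `A = ‖G_W(x,u)‖^s` and the far factor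
`Ψ = ‖G_{Λᶜ}(v',y)‖^s` under the phase-quenched measure `‖det‖·μ_W`, uniformly in the volume.  Untouched by this
line's lever. -/
theorem stub_farStability : ∀ Nf : ℕ, FarStability Nf := by
  sorry

/-- **stub 4 — the corners A5 ∧ A6 of `Core` as typed** (unit-shell lower bound, inward extension; SHARED verbatim
with `sibling-graft`).  The part of the crux AS TYPED that every seat on both closure cruxes holds MISSTATED rather
than provable (`Cruxes/FrameFMClosure/Disproof.lean` §5 `core_imp_nnCriterion` / `core_imp_diagonalBound`, sibling
Disproof §4–§5 `not_abstractFMClosureRepaired`, `LEAD-1.md` §2, `Lines/Sketch-dead.md` "common wall").  NOT attacked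
by this line and not part of its idea; carried only so that the composition concludes the crux by name.  Under the
restatements on record it is not needed: §4. -/
theorem stub_corners :
    (∀ Nf : ℕ, UnitShellLowerBound Nf) ∧
      (∀ (Nf : ℕ) (reg : QCDRegularisation Nf) (m : Fin Nf → ℝ), (∀ f, 0 < m f) →
        InwardExtension Nf reg m) := by
  sorry

/-! ## §3 Kernel-checked composition -/

/-- **Composition, core form.**  Stubs 1–4 imply the unbundled crux (the route hypothesis `FrameAPrioriBound` is
introduced and never used — census S1/S2 of `STRATEGY-CENSUS.md` stand).  Logic: stubs 1–2 give the two-star package;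
the landed closure `VonMisesCirclesC1.stub_closure` turns (two-star, far stability, collar resolvent bounds [theorem],
unit-shell corner, hopping decay [theorem], `Input`) into the outward package; the inward corner gives the
complementary package at the same exponent; `conclusion_of_outward_inward` merges them. -/
theorem core_of_four
    (hP : PaddedCofactorDominationLarge)
    (hF : ∀ Nf : ℕ, FarStability Nf)
    (hc : (∀ Nf : ℕ, UnitShellLowerBound Nf) ∧
      (∀ (Nf : ℕ) (reg : QCDRegularisation Nf) (m : Fin Nf → ℝ), (∀ f, 0 < m f) →
        InwardExtension Nf reg m)) :
    Summit.QuantumFields.QCD.Theses.GaussianLinkFrames.FrameAPrioriBound →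
      ∀ (Nf : ℕ) (reg : QCDRegularisation Nf) (m : Fin Nf → ℝ), (∀ f, 0 < m f) →
        Input Nf reg m → Conclusion Nf reg m := by
  intro _hFAB Nf reg m hm hin
  have hTS : TwoStarBounds Nf := twoStarBounds_of_paddedLarge hP Nf
  obtain ⟨s, δ, C, K₀, ℓ₀, hout⟩ :=
    _root_.Summit.QuantumFields.QCD.Theorems.VonMisesCirclesC1.stub_closure Nf reg m hm hTS (hF Nf)
      collarResolventBounds_holds (hc.1 Nf) (hoppingDecay_holds Nf) hin
  obtain ⟨δ', C', hinw⟩ := hc.2 Nf reg m hm hTS hin s δ C K₀ ℓ₀ hout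
  exact conclusion_of_outward_inward reg m hout hinw

/-- **`FrameFMClosure_of` — the skeleton theorem**: the crux BY NAME (type literally the route decl) from the four registered
stubs, via `frame_iff` + the sorry-free implication `core_of_four : stub₁ → stub₂ → stub₃ → stub₄ → (unbundled crux)`.  The only
theorem of this file concluding `FrameFMClosure`; hypothesis-free; sorries exactly inside the four `stub_*`. -/
theorem FrameFMClosure_of :
    Summit.QuantumFields.QCD.Theses.GaussianLinkFrames.FrameFMClosure :=
  frame_iff.mpr (core_of_four stub_paddedDomination stub_farStability stub_corners)

/-! ## §4 Restatement-readiness: the restated cruxes on record follow from stubs 1–3 alone (no corners)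

Nothing in this section is a stub.  It certifies that the line's OWN content (stubs 1–2) plus the shared physical
stub 3 closes every restatement of the crux proposed so far (`LEAD-1.md` §3; `Lines/sibling_graft.lean` §4;
11512's K2-out), so that stubs 1–2 are worth proving whatever the tenure planner decides about `stub_corners`. -/

/-- **K2-out shape** (11512's restatement, integrands = `cruxMoment`/`bareMass`): stubs 1–3 give, for every `N_f`,
regularisation and mass tuple, the one-scale input WITH `2 ≤ ℓ₀` ⇒ clause (ii) OUTWARD (for
`K (1 + |log a_k|) ≤ a_k ‖v‖`), by the landed `VonMisesCirclesC2B.coreOutward_of_twoStarBounds_farStability`. -/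
theorem coreOutward_of_padded
    (hP : PaddedCofactorDominationLarge)
    (hF : ∀ Nf : ℕ, FarStability Nf) :
    ∀ (Nf : ℕ) (reg : QCDRegularisation Nf) (m : Fin Nf → ℝ),
      (∀ q : ℕ, ∃ K₀ s : ℝ, 0 < s ∧ s < 1 ∧ ∀ᶠ k in atTop, ∃ ℓ₀ : ℕ, 2 ≤ ℓ₀ ∧ ℓ₀ ≤ reg.L k ∧
        (ℓ₀ : ℝ) * reg.a k ≤ K₀ * (1 + |Real.log (reg.a k)|) ∧
        ∀ S : ℕ, reg.L k ≤ S → ∀ (f : Fin Nf) (v : Literature.Probability.LatticeModels.Site 4),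
          v ∈ box 4 S → ‖v‖ = (ℓ₀ : ℝ) →
            (ℓ₀ : ℝ) ^ q * (1 + |reg.β k|) ^ q * cruxMoment Nf (reg.β k) (bareMass reg m k) S f v s ≤ 1) →
      ∃ s δ C K : ℝ, 0 < s ∧ s < 1 ∧ 0 < δ ∧ ∀ᶠ k in atTop, ∀ S : ℕ, reg.L k ≤ S →
        ∀ (f : Fin Nf) (v : Literature.Probability.LatticeModels.Site 4), v ∈ box 4 S →
          K * (1 + |Real.log (reg.a k)|) ≤ reg.a k * ‖v‖ →
            cruxMoment Nf (reg.β k) (bareMass reg m k) S f v s ≤ C * Real.exp (-(δ * (reg.a k * ‖v‖))) :=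
  coreOutward_of_twoStarBounds_farStability (twoStarBounds_of_paddedLarge hP) hF

/-- One-scale input WITH `2 ≤ ℓ₀` (A5 removed), verbatim `SiblingGraft.InputTwo`. -/
def InputTwo (Nf : ℕ) (reg : QCDRegularisation Nf) (m : Fin Nf → ℝ) : Prop :=
  ∀ q : ℕ, ∃ K₀ s : ℝ, 0 < s ∧ s < 1 ∧ ∀ᶠ k in atTop, ∃ ℓ₀ : ℕ, 2 ≤ ℓ₀ ∧ ℓ₀ ≤ reg.L k ∧
    (ℓ₀ : ℝ) * reg.a k ≤ K₀ * (1 + |Real.log (reg.a k)|) ∧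
    ∀ S : ℕ, reg.L k ≤ S → ∀ (f : Fin Nf) (v : Literature.Probability.LatticeModels.Site 4),
      v ∈ box 4 S → ‖v‖ = (ℓ₀ : ℝ) →
        (ℓ₀ : ℝ) ^ q * (1 + |reg.β k|) ^ q * cruxMoment Nf (reg.β k) (bareMass reg m k) S f v s ≤ 1

/-- Clause (ii) OUTWARD (A6 removed), verbatim `SiblingGraft.OutwardConclusion`. -/
def OutwardConclusion (Nf : ℕ) (reg : QCDRegularisation Nf) (m : Fin Nf → ℝ) : Prop :=
  ∃ s δ C K : ℝ, 0 < s ∧ s < 1 ∧ 0 < δ ∧ ∀ᶠ k in atTop, ∀ S : ℕ, reg.L k ≤ S →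
    ∀ (f : Fin Nf) (v : Literature.Probability.LatticeModels.Site 4), v ∈ box 4 S →
      K * (1 + |Real.log (reg.a k)|) ≤ reg.a k * ‖v‖ →
        cruxMoment Nf (reg.β k) (bareMass reg m k) S f v s ≤ C * Real.exp (-(δ * (reg.a k * ‖v‖)))

/-- **R1 `FrameFMClosureOutward`** for THIS route (refuter R0's clause-(i) hypothesis added, input `2 ≤ ℓ₀`, conclusion
outward; verbatim `SiblingGraft.FrameFMClosureOutward`, a weakening of the crux as typed, `SiblingGraft.outward_of_frameFMClosure`). -/
def FrameFMClosureOutward : Prop :=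
  Summit.QuantumFields.QCD.Theses.GaussianLinkFrames.FrameAPrioriBound →
    ∀ (Nf : ℕ) (reg : QCDRegularisation Nf) (m : Fin Nf → ℝ), (∀ f, 0 < m f) →
      (∀ f : Fin Nf, ∀ᶠ k in atTop, -1 < reg.mcrit k + reg.a k * m f / reg.Zm k) →
        InputTwo Nf reg m → OutwardConclusion Nf reg m

/-- R1 is closed modulo stubs 1–3 of this line (frame hypothesis, mass positivity and clause (i) unused). -/
theorem frameFMClosureOutward_of_padded
    (hP : PaddedCofactorDominationLarge)
    (hF : ∀ Nf : ℕ, FarStability Nf) : FrameFMClosureOutward :=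
  fun _ Nf reg m _ _ hin => coreOutward_of_padded hP hF Nf reg m hin

/-! ## §5 Disproof / Negative used (kernel-level cross-checks)

`Cruxes/FrameFMClosure/Disproof.lean` (cycle 1, rc 0, 0 sorry): §G guard — a refutation must prove `FrameAPrioriBound`
(irrelevant to a positive line); §2/§4 decoration — no stub uses `0 < m f`; §1 heavy corners / §2 frame window (R0) —
stub 1 is asked for probe masses `m₀ ∈ [-9,1]` (the template's range), which covers the light window `(-81/10, 1/10)`
where the crux's content lives AND the light doubler side `(-81/10,-2)` that R0 would excise, so the line does not
lean on R0; §5 A5/A7′ — honoured by `stub_corners` (inherited, flagged misstated), exactly as in `sibling-graft`.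
No `_false_without_` theorem exists for this crux.  Landed Negative lemmas: `Theorems/FrameFMClosure/Negative/FrameWindow.lean`
(p161260; `frameFMClosure_corner`, `light_doubler_side`, `window_dichotomy` — not imported here only because the farm snapshot
has not built it yet at the time of writing) concerns the crux's mass windows and corners, not any stub;
`Theorems/FibreCofactorDomination/Negative/FibreCofactorDominationFalseOfDarkLeaf.lean` (p97034: a realisable dark
leaf refutes TWO-STAR domination) is honoured by design — stub 1 is not an instance it refutes (larger fibre,
weaker statement), and its analogue (a realisable visible semi-dark exterior of a PADDED pencil) is this line's
declared kill switch. -/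

end Summit.QuantumFields.QCD.Cruxes.FrameFMClosure.PadTheFibre

end
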